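/-
Copyright (c) 2026. All rights reserved.
Released under Apache 2.0 license as described in the file LICENSE.
-/
import Literature.NumberTheory.Automorphic.AdelicVectorHeightBound
import Literature.NumberTheory.Automorphic.AdelicGroupData
import Literature.NumberTheory.Automorphic.IdeleClassGroup
import Mathlib.Analysis.Normed.Group.Ultra
import HarnessLib

/-!
# The fundamental inequality `|xᵀ y|_𝔸 ≤ h(x) · h(y)` for adelic vectors

For adelic vectors `x, y : ι → 𝔸_K` with finite height data whose scalar product `∑ᵢ xᵢ yᵢ` is an
idele `a`, the idele norm is bounded by the product of the global heights of `AdelicVectorHeight`: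
`|a|_𝔸 ≤ h(x) · h(y)` (`ideleNorm_le_vecHeight_mul_vecHeight`) — the ultrametric inequality at the
finite places (`nnnorm_dotProduct_snd_le`) and Cauchy–Schwarz at the infinite ones
(`nnnorm_dotProduct_fst_le`). This is the "Liouville / product-formula" inequality underlying
Godement's compactness criterion (R. Godement, *Domaines fondamentaux des groupes arithmétiques*,
Sém. Bourbaki 257 (1962/63), § 1.1; Platonov–Rapinchuk (1994), § 5.3).

## Provenance

LEAN-IN-TREE migration (class L) of § 1 of the Hodge-CM cell package module
`HodgeCM/PerL34/GodementCompact.lean` (expansion seat pv10-g4, 2026-08-18), verbatim modulo the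
namespace (`HodgeCM.PerL34.Godement` ↦ `Literature.NumberTheory.Automorphic`) and tree imports.
-/

set_option autoImplicit false

noncomputable section

open scoped NNReal Matrix
open NumberField IsDedekindDomain

namespace Literature.NumberTheory.Automorphic

section Fundamental

variable {K : Type} [Field K] [NumberField K] {ι : Type*} [Fintype ι]

/-- Ultrametric bound at a finite place: `|∑ᵢ xᵢ yᵢ|_v ≤ h_v(x) · h_v(y)`. [folklore] -/
theorem nnnorm_dotProduct_snd_le (v : HeightOneSpectrum (𝓞 K)) (x y : ι → AdeleRing (𝓞 K) K) :
    ‖(x ⬝ᵥ y).2 v‖₊ ≤ vecFinHeight K v x * vecFinHeight K v y := by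
  have hsum : (x ⬝ᵥ y).2 v = ∑ i, (x i).2 v * (y i).2 v := by
    rw [dotProduct, ← AdelicGroupData.adeleEval_apply (K := K) v, map_sum]
    simp only [map_mul, AdelicGroupData.adeleEval_apply]
  rw [hsum]
  refine IsUltrametricDist.nnnorm_sum_le_of_forall_le fun i _ => ?_
  rw [nnnorm_mul]
  exact mul_le_mul' (nnnorm_snd_apply_le_vecFinHeight v x i)
    (nnnorm_snd_apply_le_vecFinHeight v y i)

/-- Cauchy–Schwarz at an infinite place: `|∑ᵢ xᵢ yᵢ|_w ≤ ‖x‖_w · ‖y‖_w`. [folklore] -/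
theorem nnnorm_dotProduct_fst_le (w : InfinitePlace K) (x y : ι → AdeleRing (𝓞 K) K) :
    ‖(x ⬝ᵥ y).1 w‖₊ ≤ vecArchNorm K w x * vecArchNorm K w y := by
  have hsum : (x ⬝ᵥ y).1 w = ∑ i, (x i).1 w * (y i).1 w := by
    rw [dotProduct, ← AdeleRing.fstEval_apply w, map_sum]
    simp only [map_mul, AdeleRing.fstEval_apply]
  rw [hsum, vecArchNorm, vecArchNorm]
  calc ‖∑ i, (x i).1 w * (y i).1 w‖₊
      ≤ ∑ i, ‖(x i).1 w * (y i).1 w‖₊ := nnnorm_sum_le _ _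
    _ = ∑ i, ‖(x i).1 w‖₊ * ‖(y i).1 w‖₊ := Finset.sum_congr rfl fun i _ => nnnorm_mul _ _
    _ ≤ NNReal.sqrt (∑ i, ‖(x i).1 w‖₊ ^ 2) * NNReal.sqrt (∑ i, ‖(y i).1 w‖₊ ^ 2) :=
        NNReal.sum_mul_le_sqrt_mul_sqrt _ _ _

/-- **The fundamental inequality** (Liouville / product-formula inequality): if the scalar product
`xᵀ y = ∑ᵢ xᵢ yᵢ` of two adelic vectors with finite height data is an idele `a`, then
`|a|_𝔸 ≤ h(x) · h(y)`. [cite: Godement1964, §1.1] [cite: PlatonovRapinchuk1994, §5.3] -/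
theorem ideleNorm_le_vecHeight_mul_vecHeight {x y : ι → AdeleRing (𝓞 K) K}
    (hx : IsHeightFinite K x) (hy : IsHeightFinite K y) (a : (AdeleRing (𝓞 K) K)ˣ)
    (ha : (a : AdeleRing (𝓞 K) K) = x ⬝ᵥ y) :
    IdeleClassGroup.ideleNorm K a ≤ vecHeight K x * vecHeight K y := by
  rw [ideleNorm_apply, vecHeight, vecHeight, mul_mul_mul_comm, ← Finset.prod_mul_distrib,
    ← finprod_mul_distrib hx hy]
  refine mul_le_mul' (Finset.prod_le_prod' fun w _ => ?_) ?_
  · rw [← mul_pow]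
    refine pow_le_pow_left' ?_ _
    rw [ha]
    exact nnnorm_dotProduct_fst_le w x y
  · refine finprod_le_finprod' (hasFiniteMulSupport_nnnorm K a)
      ((hx.union hy).subset (Function.mulSupport_mul _ _)) fun v => ?_
    change ‖(a : AdeleRing (𝓞 K) K).2 v‖₊ ≤ vecFinHeight K v x * vecFinHeight K v y
    rw [ha]
    exact nnnorm_dotProduct_snd_le v x y

end Fundamental

end Literature.NumberTheory.Automorphic
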